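import Summits.ValiantsHypothesis.ValiantsHypothesis.Theses.ShallowShadows
import Literature.Computability.AlgebraicComplexity.StandardFamiliesProofs
import Summits.ValiantsHypothesis.ValiantsHypothesis.Theorems.ShadowFormulaTransfer.Negative.FalseWithoutZeroOne

/-!
# ValiantsHypothesis / ShallowShadows — item `TransferKillsPer` (stmt-ValiantsHypothesis-17130)

`ShadowFormulaTransfer → RazWigdersonMatching → PerShadow → PerZeroOne → ¬ IsVPFamily per`:
instantiate the transfer `X` at `f n = per_n` (0/1 coefficients: `PerZeroOne`; total degree `n`:
`totalDegree_perPoly_holds`), read its monotone-formula bound on the shadow of `per_n`, which is the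
perfect matching function (`PerShadow`), against Raz–Wigderson's `2^{c n}`: the analytic window
`x^{1-δ} (log(x+2))^C + C < c x` (eventually) gives the contradiction (analytic window: the landed
`ShadowFormulaTransfer.Negative.eventually_window`). HONEST FRAMING: glue over OPEN / literature
cruxes of a dormant route; nothing here is progress on `VP ≠ VNP`.
-/

-- layout Summits/ValiantsHypothesis/ValiantsHypothesis forces the duplicated namespace component
set_option linter.dupNamespace false

namespace Summit.ValiantsHypothesis.ValiantsHypothesis.Theorems.ShallowShadows

open Literature.Computability.AlgebraicComplexity MvPolynomial Filter

/-- **Item `TransferKillsPer` (stmt-ValiantsHypothesis-17130):**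
`ShadowFormulaTransfer → RazWigdersonMatching → PerShadow → PerZeroOne → ¬ IsVPFamily per`.
[folklore] -/
theorem transferKillsPer_proof : Theses.ShallowShadows.TransferKillsPer := by
  unfold Theses.ShallowShadows.TransferKillsPer Theses.ShallowShadows.ShadowFormulaTransfer
    Theses.ShallowShadows.RazWigdersonMatching Theses.ShallowShadows.PerShadow
    Theses.ShallowShadows.PerZeroOne
  intro h1 hRW hShadow h01 hVP
  obtain ⟨δ, hδ, C, hC⟩ := h1
  obtain ⟨n₀, hn₀⟩ := hC (fun n => Fin n × Fin n) (fun n => perPoly (Fin n) ℂ) hVP h01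
  obtain ⟨c, hc, m₀, hm₀⟩ := hRW
  obtain ⟨N, hN⟩ := eventually_atTop.mp
    ((tendsto_natCast_atTop_atTop (R := ℝ)).eventually (ShadowFormulaTransfer.Negative.eventually_window δ hδ C c hc))
  let n : ℕ := max (max n₀ m₀) N
  have hn₀' : n₀ ≤ n := (le_max_left _ _).trans (le_max_left _ _)
  have hm₀' : m₀ ≤ n := (le_max_right _ _).trans (le_max_left _ _)
  have hN' : N ≤ n := le_max_right _ _
  have hb := hn₀ n hn₀'
  have hr := hm₀ n hm₀'
  have hw := hN n hN'
  simp only [hShadow] at hb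
  have htd : (perPoly (Fin n) ℂ).totalDegree = n :=
    (totalDegree_perPoly_holds (n := Fin n) (k := ℂ)).trans (Fintype.card_fin n)
  rw [htd] at hb
  have hchain := hr.trans hb
  rw [Real.rpow_le_rpow_left_iff (by norm_num : (1 : ℝ) < 2)] at hchain
  linarith

end Summit.ValiantsHypothesis.ValiantsHypothesis.Theorems.ShallowShadows
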